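import Summits.RiemannHypothesis.RiemannHypothesis.Theses.RobinStaircase
import Summits.RiemannHypothesis.RiemannHypothesis.Theorems.Splittings.RobinFiniteStairSqrtCert
import HarnessLib

/-!
# Route RobinStaircase (L7 «ROBIN · FINITE STAIRCASE») — `KernelBase` (item stmt-RiemannHypothesis-22080) closed BY NAME

KERNEL ROW (computational class): the two θ-prints alone (Büthe 2018 Thm 2, BKLNW 2021 Table 15) give Robin's inequality at
every colossally abundant `N > 5040` with all primes `< 583 000 001`, the needed `RH(10⁵)` being the tree's compiled
Riemann–Siegel certificate `riemannHypothesisUpTo_100000` — verbatim the lane (ix-n) tree theorem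
`Summit.RiemannHypothesis.RiemannHypothesis.Theorems.Splittings.RobinFiniteC1.robinCA_below_stairS_cert`
(Theorems/Splittings/RobinFiniteStairSqrtCert.lean; its axiom closure carries the certificate's `native_decide`
auxiliaries ⇒ filed `--computational`). One-line closer. CONDITIONAL on the two printed θ-facts (hypotheses); RH is not
proved by this; nothing here bears on the truth of RH.
-/

-- D-0017: `Summit.RiemannHypothesis.RiemannHypothesis.…` duplicates the namespace BY DESIGN (single-problem summit).
set_option linter.dupNamespace false

namespace Summit.RiemannHypothesis.RiemannHypothesis.Theorems.RobinStaircase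

/-- **Row `KernelBase` (item stmt-RiemannHypothesis-22080)**: θ-prints ⟹ `robinCA_below 583000001` (RH to height 10⁵
from the compiled certificate) — the tree theorem `Splittings.RobinFiniteC1.robinCA_below_stairS_cert`, by name. -/
theorem kernelBase_proof :
    Summit.RiemannHypothesis.RiemannHypothesis.Theses.RobinStaircase.KernelBase :=
  fun hB hK ↦ Splittings.RobinFiniteC1.robinCA_below_stairS_cert hB hK

end Summit.RiemannHypothesis.RiemannHypothesis.Theorems.RobinStaircase
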